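import Literature.Analysis.FluidPDE.HardSphereCollisionRecord
import HarnessLib

/-!
# Marked collision sums along good orbits of a hard-sphere flow: windows and energy-shell marks

Topic `Literature/MathematicalPhysics/KineticTheory`. Pathwise bookkeeping of the marked collision
pair sums `Φ.collisionPairSum S g z = Σ_{s ∈ collisionTimes ∩ S} Σ_{(i,j) in contact at s} g (Φ_s z) i j`
along the orbit of a GOOD initial datum `z` of a hard-sphere flow `Φ : HardSphereFlow G ε N`
(Gallagher–Saint-Raymond–Texier 2013, Prop. 4.1.1 / Def. 4.1.2: on the good set the flow is a
one-parameter group of hard-sphere trajectories with locally finitely many, binary collisions).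
These are the two deterministic inputs of the discharge of the named fact
`HardSphereCampbellFormula` (the stationary collision-rate / special-flow identity of
Cercignani–Illner–Pulvirenti 1994, App. 4.A: `E_Liouville[CPS_{(0,τ]}(g)] = τ · flux(g)`):

* `campbell_collisionTimes_flow_shift`, `campbell_collisionPairSum_flow_shift`,
  `campbell_collisionPairSum_flow_shift_Ioc` — THE SHIFT: by the group property
  `Φ_u (Φ_s z) = Φ_{u+s} z` the collision times of the orbit of `Φ_s z` are the translated
  collision times of the orbit of `z`, and the collision pair sum of a time-independent mark over
  `(a, b]` along the orbit of `Φ_s z` is the one over `(a + s, b + s]` along the orbit of `z`;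
* `campbell_collisionPairSum_Ioc_split` — additivity `(0, τ'] = (0, τ] ∪ (τ, τ']`;
* `collisionPairSum_windows` — THE WINDOW DECOMPOSITION (stationarity step): the sum over
  `(0, (m+1)δ]` of the orbit of `z` is the sum over `w ≤ m` of the sums over `(0, δ]` of the
  orbits of the window starts `Φ_{wδ} z`;
* `collisionPairSum_shellMark` — ENERGY-SHELL MARKS COUNT EACH COLLISION TWICE: for the mark
  `c · 1{E ≤ E₀}` (flow-invariant by conservation of energy,
  `IsHardSphereTrajectory.configEnergy_eq_holds`) each collision time carries exactly the two
  ordered contact pairs `(p, q), (q, p)` (`IsHardSphereTrajectory.card_contactPairs_eq_two`, the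
  torus with `ε < 1/2` being hard-sphere regular), so the sum is
  `2c · #(collisionTimes ∩ (0, t])` on the shell and `0` off it.

## Mathlib / Literature reuse

`HardSphereCollisionRecord` (`collisionPairSum_eq_finset_sum`, `collisionPairSum_union`,
`HardSphereFlow.finite_collisionTimes_inter`, `IsHardSphereTrajectory.card_contactPairs_eq_two`),
`HardSphereDynamicsProofs` (`IsHardSphereTrajectory.configEnergy_eq_holds`),
`HardSphereRegularGeometry` (`Torus.isHardSphereRegular_geometry`). Mathlib:
`finsum_mem_eq_of_bijOn`, `Set.preimage_sub_const_Ioc`, `Set.Ioc_union_Ioc_eq_Ioc`,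
`Set.Ioc_disjoint_Ioc_of_le`, `Finset.sum_range_succ`, `Set.ncard_eq_toFinset_card`.

## References

* C. Cercignani, R. Illner, M. Pulvirenti, *The Mathematical Theory of Dilute Gases*, Springer
  (1994), §4.2, App. 4.A pp. 107–111 (special-flow representation / Campbell identity).
* I. Gallagher, L. Saint-Raymond, B. Texier, *From Newton to Boltzmann: hard spheres and
  short-range potentials*, EMS (2013), arXiv:1208.5753, §4.1, Prop. 4.1.1, Def. 4.1.2.
-/

open MeasureTheory Set Function Filter Metric
open scoped ENNReal NNReal RealInnerProductSpace

namespace Literature.MathematicalPhysics.KineticTheory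

open Literature.Analysis.FluidPDE

noncomputable section

variable {d : Type*} [Fintype d] {N : ℕ} {ε : ℝ}

/-! ## The shift along the flow -/

section Shift

variable {X : Type*} [MeasureSpace X] [TopologicalSpace X] {G : Geometry d X}

/-- **Collision times along a shifted orbit**: for good `z`, the collision times of the orbit of
`Φ_s z` are the collision times of the orbit of `z` translated by `-s`
(`u ∈ CT(Φ_s z) ↔ u + s ∈ CT(z)`, by the group property `Φ_u (Φ_s z) = Φ_{u+s} z`). [folklore] -/
theorem campbell_collisionTimes_flow_shift (Φ : HardSphereFlow G ε N) {z : Config N d X}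
    (hz : z ∈ Φ.good) (s : ℝ) :
    collisionTimes G ε (fun u => Φ.flow u (Φ.flow s z)) =
      (fun u => u + s) ⁻¹' collisionTimes G ε (fun u => Φ.flow u z) := by
  ext u
  simp only [mem_preimage, mem_collisionTimes]
  rw [← Φ.flow_add u s z hz]

/-- **The shift of a marked collision sum along the flow** (time-independent marks): for good `z`
and any set of times `S`, the collision pair sum over `S` along the orbit of `Φ_s z` is the
collision pair sum over `{u | u - s ∈ S}` along the orbit of `z`. [folklore] -/
theorem campbell_collisionPairSum_flow_shift {M : Type*} [AddCommMonoid M]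
    (Φ : HardSphereFlow G ε N) {z : Config N d X} (hz : z ∈ Φ.good) (s : ℝ) (S : Set ℝ)
    (g : Config N d X → Fin N → Fin N → M) :
    Φ.collisionPairSum S (fun _ w i j => g w i j) (Φ.flow s z) =
      Φ.collisionPairSum ((fun u => u - s) ⁻¹' S) (fun _ w i j => g w i j) z := by
  unfold HardSphereFlow.collisionPairSum Literature.Analysis.FluidPDE.collisionPairSum
  rw [campbell_collisionTimes_flow_shift Φ hz s]
  refine finsum_mem_eq_of_bijOn (fun u => u + s) ⟨?_, ?_, ?_⟩ ?_
  · rintro u ⟨hu, huS⟩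
    exact ⟨hu, by simpa only [mem_preimage, add_sub_cancel_right] using huS⟩
  · exact (add_left_injective s).injOn
  · rintro u ⟨hu, huS⟩
    exact ⟨u - s, ⟨by simpa only [mem_preimage, sub_add_cancel] using hu, huS⟩, sub_add_cancel u s⟩
  · intro u _
    simp only [← Φ.flow_add u s z hz]

/-- **The shift of a marked collision sum over a window**: for good `z`, the collision pair sum
of a time-independent mark over `(a, b]` along the orbit of `Φ_s z` is the one over
`(a + s, b + s]` along the orbit of `z`. [folklore] -/
theorem campbell_collisionPairSum_flow_shift_Ioc {M : Type*} [AddCommMonoid M]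
    (Φ : HardSphereFlow G ε N) {z : Config N d X} (hz : z ∈ Φ.good) (s a b : ℝ)
    (g : Config N d X → Fin N → Fin N → M) :
    Φ.collisionPairSum (Ioc a b) (fun _ w i j => g w i j) (Φ.flow s z) =
      Φ.collisionPairSum (Ioc (a + s) (b + s)) (fun _ w i j => g w i j) z := by
  rw [campbell_collisionPairSum_flow_shift Φ hz s, Set.preimage_sub_const_Ioc]

/-- **Additivity in the window along a good orbit**: `(0, τ'] = (0, τ] ∪ (τ, τ']` for
`0 ≤ τ ≤ τ'` (finitely many collision times in each bounded window). [folklore] -/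
theorem campbell_collisionPairSum_Ioc_split {M : Type*} [AddCommMonoid M]
    (Φ : HardSphereFlow G ε N) {z : Config N d X} (hz : z ∈ Φ.good) {τ τ' : ℝ} (hτ : 0 ≤ τ)
    (hττ' : τ ≤ τ') (g : ℝ → Config N d X → Fin N → Fin N → M) :
    Φ.collisionPairSum (Ioc 0 τ') g z =
      Φ.collisionPairSum (Ioc 0 τ) g z + Φ.collisionPairSum (Ioc τ τ') g z := by
  unfold HardSphereFlow.collisionPairSum
  rw [← Ioc_union_Ioc_eq_Ioc hτ hττ']
  exact collisionPairSum_union (Φ.finite_collisionTimes_inter hz Ioc_subset_Icc_self)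
    (Φ.finite_collisionTimes_inter hz Ioc_subset_Icc_self) (Ioc_disjoint_Ioc_of_le le_rfl) _

end Shift

/-! ## The window decomposition and the energy-shell marks on the torus -/

/-- **Window decomposition of a marked collision sum (stationarity bookkeeping)**: for a good
initial datum `z`, `0 ≤ δ` and a time-independent mark `g`, the collision pair sum over
`(0, (m+1)δ]` along the orbit of `z` is the sum over the window indices `w ≤ m` of the collision
pair sums over `(0, δ]` along the orbits of the window starts `Φ_{wδ} z` (group property of the
flow on the good set; GST 2013 Prop. 4.1.1). [folklore] -/
theorem collisionPairSum_windows (Φ : HardSphereFlow (Torus.geometry d) ε N)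
    {z : Config N d (UnitAddTorus d)} (hz : z ∈ Φ.good) {δ : ℝ} (hδ : 0 ≤ δ) (m : ℕ)
    (g : Config N d (UnitAddTorus d) → Fin N → Fin N → ℝ≥0∞) :
    Φ.collisionPairSum (Ioc 0 (((m : ℝ) + 1) * δ)) (fun _ w i j => g w i j) z =
      ∑ w ∈ Finset.range (m + 1),
        Φ.collisionPairSum (Ioc 0 δ) (fun _ w i j => g w i j) (Φ.flow ((w : ℝ) * δ) z) := by
  induction m with
  | zero =>
    simp only [Nat.cast_zero, zero_add, one_mul, Finset.sum_range_one, zero_mul, Φ.flow_zero z hz]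
  | succ m ih =>
    have h1 : (0 : ℝ) ≤ ((m : ℝ) + 1) * δ := by positivity
    have h2 : ((m : ℝ) + 1) * δ ≤ ((m : ℝ) + 1 + 1) * δ :=
      mul_le_mul_of_nonneg_right (le_add_of_nonneg_right zero_le_one) hδ
    rw [Finset.sum_range_succ, ← ih, campbell_collisionPairSum_flow_shift_Ioc Φ hz, zero_add,
      Nat.cast_succ, show δ + ((m : ℝ) + 1) * δ = ((m : ℝ) + 1 + 1) * δ by ring]
    exact campbell_collisionPairSum_Ioc_split Φ hz h1 h2 _

/-- **Energy-shell marks count each collision twice**: on the torus with `ε < 1/2`, for a good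
initial datum `z`, the collision pair sum over `(0, t]` of the mark `c · 1{E ≤ E₀}` is
`2c · #(collisionTimes ∩ (0, t])` if `E(z) ≤ E₀` and `0` otherwise: the energy is conserved along
the orbit (`IsHardSphereTrajectory.configEnergy_eq_holds`) and each collision time carries exactly
the two ordered contact pairs `(p, q), (q, p)` (`IsHardSphereTrajectory.card_contactPairs_eq_two`).
[folklore] -/
theorem collisionPairSum_shellMark (hε' : ε < 2⁻¹) (Φ : HardSphereFlow (Torus.geometry d) ε N)
    {z : Config N d (UnitAddTorus d)} (hz : z ∈ Φ.good) (E₀ : ℝ) (c : ℝ≥0) (t : ℝ) :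
    Φ.collisionPairSum (Ioc 0 t)
        (fun _ w (_ _ : Fin N) => if configEnergy w ≤ E₀ then (c : ℝ≥0∞) else 0) z =
      if configEnergy z ≤ E₀ then
        2 * (c : ℝ≥0∞) * ((collisionTimes (Torus.geometry d) ε (fun s => Φ.flow s z) ∩ Ioc 0 t).ncard : ℝ≥0∞)
      else 0 := by
  have hfin := Φ.finite_collisionTimes_inter hz (Ioc_subset_Icc_self : Ioc 0 t ⊆ Icc 0 t)
  have hG := Torus.isHardSphereRegular_geometry (d := d) hε'
  have htraj := Φ.isTrajectory z hz
  have hE : ∀ s, configEnergy (Φ.flow s z) = configEnergy z := fun s => by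
    have hcons := IsHardSphereTrajectory.configEnergy_eq_holds htraj s 0
    simpa only [Φ.flow_zero z hz] using hcons
  have hsum : ∀ s ∈ hfin.toFinset,
      ∑ p ∈ contactPairs (Torus.geometry d) ε (Φ.flow s z),
        (if configEnergy (Φ.flow s z) ≤ E₀ then (c : ℝ≥0∞) else 0) =
      2 * if configEnergy z ≤ E₀ then (c : ℝ≥0∞) else 0 := by
    intro s hs
    rw [Finset.sum_const, htraj.card_contactPairs_eq_two hG (hfin.mem_toFinset.1 hs).1, hE s,
      two_nsmul, two_mul]
  unfold HardSphereFlow.collisionPairSum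
  rw [collisionPairSum_eq_finset_sum hfin, Finset.sum_congr rfl hsum, Finset.sum_const, nsmul_eq_mul,
    Set.ncard_eq_toFinset_card _ hfin]
  split_ifs <;> ring

end

end Literature.MathematicalPhysics.KineticTheory
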